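import Summits.QuantumFields.YangMills.Theorems.ParabolicTrajectoryLatticeGapOnTrajectoryStubSmoothingToGap
import Summits.QuantumFields.YangMills.Theorems.ParabolicTrajectoryLatticeGapOnTrajectoryStubTorusFrames
import HarnessLib

/-!
# Crux `LatticeGapOnTrajectory` (stmt-QuantumFields-10523), line `orbit-kantorovich-finite-size`:
# slab clustering — the two-region tower identity and the coarse time geometry of slabs

Helper file (`--supports stmt-QuantumFields-10523`) for the registered stub `stub_slabClustering`
(G-blind; nothing about mass gaps is asserted, everything here is proved).

* §1 `abs_corr_le_of_layers` (registered helper): the TOWER identity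
  `∫ f g − ∫ f ∫ g = cov(γ_{Λ_F} f, γ_{Λ_G} g)` for two observables supported in disjoint regions
  `Λ_F, Λ_G` of an abstract specification read on cells (DLR for functions + pull-out,
  `SpecificationTower`), followed by the Dobrushin–Shlosman/Kantorovich ENGINE applied to the two
  region averages, which are functions of cell layers `Δ_F, Δ_G` with constant cell-Lipschitz
  bounds: `|…| ≤ C₀ (|Δ_F| δ_F)(|Δ_G| δ_G) e^{−κ D}` — the multi-cell analogue of `abs_corr_le_far`.
* §2 Natural-number labels of the uniform frame `uframe` of `stub_torusFrames` (`ulabel` of the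
  offset from the origin): cast injectivity, the `0/1` step in `ℕ`, labels near a label interval,
  and the cyclic label distance from below (`le_natAbs_valMinAbs_natCast`).
* §3 The time geometry of the two slabs of the reflected autocorrelation on the torus of side
  `2L+1` with the origin `o = −(w+1+2b)`: the reflected slab (lattice times `2L−w … 2L`) has labels
  in `[2, 2 + w/b]`, the shifted slab (times `N+1 … N+w`) in `[g₁, g₂]`,
  `g₁ = (N+w+2)/b + 2`, `g₂ = (N+2w+1)/b + 2`, the order / separation facts used by the engine
  (`slab_labels_apart`), and the time coordinates of plaquettes based in the shadow of an edge set.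

References: Dobrushin–Shlosman 1985; Föllmer 1988 Ch. I §2; Georgii 2011 Def. 1.23, §8.2.
-/

namespace Summit.QuantumFields.YangMills.Cruxes.LatticeGapOnTrajectory.OrbitKantorovichFiniteSize

open scoped BigOperators ENNReal ProbabilityTheory
open Filter MeasureTheory
open Literature.Probability.LatticeModels (Specification IsSpecification IsGibbsMeasure glueWith)
open Literature.MathematicalPhysics.QuantumFieldTheory

noncomputable section

namespace SlabClustering

/-! ### §1 The two-region tower identity and the engine -/

/-- **Two-region tower identity + engine.** For a specification `γ` on a finite site set read on
cells with the KR window package, a Gibbs measure `ν`, bounded measurable `f`, `g` with `g` reading only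
`Λ_G`, disjoint from `Λ_F`, whose region averages `γ_{Λ_F} f`, `γ_{Λ_G} g` read only the cell
layers `Δ_F`, `Δ_G` (with `Δ_F` off `Λ_G`) and are cell-Lipschitz with constant bounds `δ_F`,
`δ_G`, and `D ≤ cdist` between `Δ_F` and `Δ_G`:
`|∫ f g dν − ∫ f dν ∫ g dν| ≤ C₀ (|Δ_F| δ_F) (|Δ_G| δ_G) e^{−κ D}`
(`∫ f g = ∫ γ_{Λ_F}(g f) = ∫ g γ_{Λ_F} f = ∫ γ_{Λ_G}(γ_{Λ_F}f · g) = ∫ γ_{Λ_F} f · γ_{Λ_G} g`). -/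
theorem abs_corr_le_of_layers {μ : Fin 4 → ℕ} {V S : Type} [Fintype V] [MeasurableSpace S]
    (hT : SpecificationTower) {n₀ : ℕ} {γ₀ R κ C₀ : ℝ}
    (hEng : ∀ (μ : Fin 4 → ℕ) (V S : Type) [Fintype V] [MeasurableSpace S]
      (cell : V → CoarseIdx μ) (w : CoarseIdx μ → (V → S) → (V → S) → ℝ)
      (γ : Specification V S) (k : CoarseIdx μ → CoarseIdx μ → CoarseIdx μ → ℝ),
      (∀ i, 2 * n₀ + 3 ≤ μ i + 1) → IsSpecification γ → IsKRWindow cell w γ R n₀ γ₀ k →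
      ∀ ν : Measure (V → S), IsGibbsMeasure γ ν →
      ∀ (f g : (V → S) → ℝ) (Δf Δg : Finset (CoarseIdx μ)) (δf δg : CoarseIdx μ → ℝ) (D : ℕ),
        Measurable f → Measurable g → (∃ B, ∀ σ, |f σ| ≤ B) → (∃ B, ∀ σ, |g σ| ≤ B) →
        DependsOn f {v | cell v ∈ Δf} → DependsOn g {v | cell v ∈ Δg} →
        IsCellLipBound cell w f δf → IsCellLipBound cell w g δg →
        (∀ x ∈ Δf, ∀ y ∈ Δg, D ≤ cdist x y) →
          |cov[f, g; ν]| ≤ C₀ * (∑ x ∈ Δf, δf x) * (∑ y ∈ Δg, δg y) * Real.exp (-(κ * D)))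
    (cell : V → CoarseIdx μ) (w : CoarseIdx μ → (V → S) → (V → S) → ℝ) (γ : Specification V S)
    (kp : CoarseIdx μ → CoarseIdx μ → CoarseIdx μ → ℝ)
    (hμ : ∀ i, 2 * n₀ + 3 ≤ μ i + 1) (hγ : IsSpecification γ) (hKR : IsKRWindow cell w γ R n₀ γ₀ kp)
    (ν : Measure (V → S)) (hν : IsGibbsMeasure γ ν)
    {f g : (V → S) → ℝ} {CA CB : ℝ} (hfm : Measurable f) (hgm : Measurable g)
    (hfb : ∀ σ, |f σ| ≤ CA) (hgb : ∀ σ, |g σ| ≤ CB)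
    (ΛF ΛG : Finset V) (hgdep : DependsOn g (↑ΛG : Set V))
    (hdisj : Disjoint ΛF ΛG) (ΔF ΔG : Finset (CoarseIdx μ))
    (hFh : DependsOn (windowAvg γ ΛF f) {v | cell v ∈ ΔF})
    (hGh : DependsOn (windowAvg γ ΛG g) {v | cell v ∈ ΔG})
    (hΔFG : ∀ v ∈ ΛG, cell v ∉ ΔF) {δF δG : ℝ}
    (hLipF : IsCellLipBound cell w (windowAvg γ ΛF f) (fun _ => δF))
    (hLipG : IsCellLipBound cell w (windowAvg γ ΛG g) (fun _ => δG))
    (D : ℕ) (hD : ∀ x ∈ ΔF, ∀ y ∈ ΔG, D ≤ cdist x y) :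
    |(∫ σ, f σ * g σ ∂ν) - (∫ σ, f σ ∂ν) * ∫ σ, g σ ∂ν| ≤
      C₀ * (ΔF.card * δF) * (ΔG.card * δG) * Real.exp (-(κ * D)) := by
  -- adapted from `abs_corr_le_far` (…StubSmoothingToGapHelpers): regions instead of windows
  classical
  haveI : IsProbabilityMeasure ν := hν.1
  obtain ⟨hfhm, hfhb, -, hpullF, hdlrF⟩ := hT V S γ hγ ΛF f CA hfm hfb
  obtain ⟨hghm, hghb, -, hpullG, hdlrG⟩ := hT V S γ hγ ΛG g CB hgm hgb
  set fh : (V → S) → ℝ := windowAvg γ ΛF f with hfh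
  set gh : (V → S) → ℝ := windowAvg γ ΛG g with hgh
  have hg_offF : DependsOn g ((↑ΛF : Set V)ᶜ) :=
    hgdep.mono fun v hv => Finset.disjoint_right.1 hdisj (Finset.mem_coe.1 hv)
  have hfh_offG : DependsOn fh ((↑ΛG : Set V)ᶜ) := hFh.mono fun v hv hvG =>
    hΔFG v (Finset.mem_coe.1 hvG) hv
  have hgf_b : ∀ σ, |g σ * f σ| ≤ CB * CA := fun σ => by
    rw [abs_mul]
    exact mul_le_mul (hgb σ) (hfb σ) (abs_nonneg _) ((abs_nonneg _).trans (hgb σ))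
  have hfhg_b : ∀ σ, |fh σ * g σ| ≤ CA * CB := fun σ => by
    rw [abs_mul]
    exact mul_le_mul (hfhb σ) (hgb σ) (abs_nonneg _) ((abs_nonneg _).trans (hfhb σ))
  have step1 : ∫ σ, f σ * g σ ∂ν = ∫ σ, g σ * fh σ ∂ν := by
    have hdlr := (hT V S γ hγ ΛF (fun σ => g σ * f σ) (CB * CA) (hgm.mul hfm) hgf_b).2.2.2.2 ν hν
    have hp : ∀ η, windowAvg γ ΛF (fun σ => g σ * f σ) η = g η * fh η :=
      hpullF g hgm ⟨CB, hgb⟩ hg_offF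
    simp_rw [hp] at hdlr
    rw [hdlr]
    exact integral_congr_ae (Eventually.of_forall fun σ => mul_comm _ _)
  have step2 : ∫ σ, g σ * fh σ ∂ν = ∫ σ, fh σ * gh σ ∂ν := by
    have hdlr := (hT V S γ hγ ΛG (fun σ => fh σ * g σ) (CA * CB) (hfhm.mul hgm) hfhg_b).2.2.2.2 ν hν
    have hp : ∀ η, windowAvg γ ΛG (fun σ => fh σ * g σ) η = fh η * gh η :=
      hpullG fh hfhm ⟨CA, hfhb⟩ hfh_offG
    simp_rw [hp] at hdlr
    rw [hdlr]
    exact integral_congr_ae (Eventually.of_forall fun σ => mul_comm _ _)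
  have step3 : ∫ σ, f σ ∂ν = ∫ σ, fh σ ∂ν := (hdlrF ν hν).symm
  have step4 : ∫ σ, g σ ∂ν = ∫ σ, gh σ ∂ν := (hdlrG ν hν).symm
  have hfh2 : MemLp fh 2 ν := MemLp.of_bound hfhm.aestronglyMeasurable CA
    (Eventually.of_forall fun σ => by rw [Real.norm_eq_abs]; exact hfhb σ)
  have hgh2 : MemLp gh 2 ν := MemLp.of_bound hghm.aestronglyMeasurable CB
    (Eventually.of_forall fun σ => by rw [Real.norm_eq_abs]; exact hghb σ)
  have hcov : cov[fh, gh; ν] = (∫ σ, fh σ * gh σ ∂ν) - (∫ σ, fh σ ∂ν) * ∫ σ, gh σ ∂ν :=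
    ProbabilityTheory.covariance_eq_sub hfh2 hgh2
  have htower : (∫ σ, f σ * g σ ∂ν) - (∫ σ, f σ ∂ν) * ∫ σ, g σ ∂ν = cov[fh, gh; ν] := by
    rw [hcov, step1, step2, step3, step4]
  have hcovb := hEng μ V S cell w γ kp hμ hγ hKR ν hν fh gh ΔF ΔG (fun _ => δF) (fun _ => δG) D
    hfhm hghm ⟨CA, hfhb⟩ ⟨CB, hghb⟩ hFh hGh hLipF hLipG hD
  rw [htower]
  refine hcovb.trans (le_of_eq ?_)
  rw [Finset.sum_const, Finset.sum_const, nsmul_eq_mul, nsmul_eq_mul]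

/-! ### §2 Natural-number labels of the uniform frame -/

section Labels

variable {Sd b K : ℕ}

/-- Casting `[0, K]` into `ℤ/(K+1)` is injective. -/
theorem natCast_inj_of_le {m n : ℕ} (hm : m ≤ K) (hn : n ≤ K) (h : (m : ZMod (K + 1)) = n) :
    m = n := by
  have := (ZMod.natCast_eq_natCast_iff' m n (K + 1)).1 h
  rwa [Nat.mod_eq_of_lt (Nat.lt_succ_of_le hm), Nat.mod_eq_of_lt (Nat.lt_succ_of_le hn)] at this

/-- Labels are at most `K`. -/
theorem ulabel_le (t : ℕ) : StubTorusFrames.ulabel b K t ≤ K := min_le_right _ _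

/-- Below the last cell the label is the integer quotient of the offset. -/
theorem ulabel_eq_div {t : ℕ} (hb : 0 < b) (ht : t < K * b) : StubTorusFrames.ulabel b K t = t / b :=
  min_eq_left ((Nat.div_lt_iff_lt_mul hb).2 ht).le

/-- **The `0/1` step of the uniform frame in `ℕ`**: one lattice step changes the label by `0` or
`+1`, except at the wrap `K ↦ 0`. -/
theorem ulabel_step [NeZero Sd] (hb : 0 < b) (hK : K + 1 = Sd / b) (o z : ZMod Sd) :
    StubTorusFrames.ulabel b K (z + 1 - o).val = StubTorusFrames.ulabel b K (z - o).val ∨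
      StubTorusFrames.ulabel b K (z + 1 - o).val = StubTorusFrames.ulabel b K (z - o).val + 1 ∨
      (StubTorusFrames.ulabel b K (z - o).val = K ∧ StubTorusFrames.ulabel b K (z + 1 - o).val = 0) := by
  have hstep := StubTorusFrames.uframe_step hb hK o z
  simp only [StubTorusFrames.uframe] at hstep
  set l₁ := StubTorusFrames.ulabel b K (z + 1 - o).val with hl₁
  set l₀ := StubTorusFrames.ulabel b K (z - o).val with hl₀
  have h₀ : l₀ ≤ K := ulabel_le _
  have h₁ : l₁ ≤ K := ulabel_le _
  rcases hstep with h | h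
  · exact Or.inl (natCast_inj_of_le h₁ h₀ h)
  · by_cases hzK : l₀ + 1 ≤ K
    · refine Or.inr (Or.inl (natCast_inj_of_le h₁ hzK ?_))
      rw [h]; push_cast; rfl
    · have hz : l₀ = K := by omega
      refine Or.inr (Or.inr ⟨hz, natCast_inj_of_le h₁ (Nat.zero_le K) ?_⟩)
      rw [h, hz, ← Nat.cast_succ, ZMod.natCast_self, Nat.cast_zero]

/-- Labels of the neighbours `t ± 1` of a time whose label lies in `[lo, hi]`, `1 ≤ lo`,
`hi + 1 ≤ K` (no wrap): they lie in `[lo − 1, hi + 1]`. -/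
theorem ulabel_neighbours [NeZero Sd] (hb : 0 < b) (hK : K + 1 = Sd / b) (o t : ZMod Sd)
    {lo hi : ℕ} (hlo : 1 ≤ lo) (hhi : hi + 1 ≤ K)
    (ht : lo ≤ StubTorusFrames.ulabel b K (t - o).val ∧ StubTorusFrames.ulabel b K (t - o).val ≤ hi) :
    (lo - 1 ≤ StubTorusFrames.ulabel b K (t + 1 - o).val ∧
        StubTorusFrames.ulabel b K (t + 1 - o).val ≤ hi + 1) ∧
      (lo - 1 ≤ StubTorusFrames.ulabel b K (t - 1 - o).val ∧
        StubTorusFrames.ulabel b K (t - 1 - o).val ≤ hi + 1) := by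
  constructor
  · rcases ulabel_step hb hK o t with h | h | ⟨h, -⟩ <;> omega
  · have hs := ulabel_step hb hK o (t - 1)
    rw [sub_add_cancel] at hs
    rcases hs with h | h | ⟨-, h⟩ <;> omega

/-- **The cyclic label distance from below**: for `u < m`, `D ≤ u` and `D ≤ m − u` give
`D ≤ |valMinAbs (u : ℤ/m)|`. -/
theorem le_natAbs_valMinAbs_natCast {m u D : ℕ} [NeZero m] (hu : u < m) (h1 : D ≤ u)
    (h2 : D ≤ m - u) : D ≤ ((u : ZMod m).valMinAbs).natAbs := by
  have hval : (u : ZMod m).val = u := ZMod.val_natCast_of_lt hu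
  rw [ZMod.valMinAbs_def_pos, hval]
  split_ifs with h
  · rw [Int.natAbs_natCast]; exact h1
  · have : ((u : ℤ) - (m : ℤ)).natAbs = m - u := by omega
    rw [this]; exact h2

/-- Coarse distance from below through the time axis: cells whose time labels are `ℓ₁ ≤ ℓ₂ ≤ K`
with `D ≤ ℓ₂ − ℓ₁` and `D ≤ K + 1 − (ℓ₂ − ℓ₁)` are at coarse distance `≥ D`. -/
theorem le_cdist_of_labels {μ : Fin 4 → ℕ} (hμ : μ 0 = K) (x y : CoarseIdx μ) {ℓ₁ ℓ₂ D : ℕ}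
    (hx : x 0 = (ℓ₁ : ZMod (μ 0 + 1))) (hy : y 0 = (ℓ₂ : ZMod (μ 0 + 1))) (h12 : ℓ₁ ≤ ℓ₂)
    (h2 : ℓ₂ ≤ K) (hD1 : D ≤ ℓ₂ - ℓ₁) (hD2 : D ≤ K + 1 - (ℓ₂ - ℓ₁)) : D ≤ cdist x y := by
  refine le_trans ?_ (natAbs_valMinAbs_sub_le_cdist x y 0)
  rw [hx, hy, ← neg_sub, ZMod.natAbs_valMinAbs_neg, ← Nat.cast_sub h12]
  subst hμ
  exact le_natAbs_valMinAbs_natCast (by omega) hD1 hD2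

end Labels

/-! ### §3 The time geometry of the two slabs -/

section Slabs

variable {L b K w N : ℕ}

/-- The offset of a NEGATIVE time `z` (`2L − w ≤ z.val`) from the origin `o = −(w+1+2b)` on the
torus of side `2L+1`: `(z − o).val = z.val + w + 1 + 2b − (2L+1)`. -/
theorem val_sub_origin_of_neg (hwb : w + 1 + 2 * b < 2 * L + 1) (z : ZMod (2 * L + 1))
    (hz : 2 * L - w ≤ z.val) :
    (z - -(((w + 1 + 2 * b : ℕ) : ZMod (2 * L + 1)))).val = z.val + (w + 1 + 2 * b) - (2 * L + 1) := by
  have hzlt := ZMod.val_lt z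
  rw [sub_neg_eq_add, ZMod.val_add, ZMod.val_natCast_of_lt hwb, Nat.mod_eq_sub_mod (by omega),
    Nat.mod_eq_of_lt (by omega)]

/-- The offset of a small POSITIVE time `z` (`z.val + w + 1 + 2b < 2L+1`) from the origin:
`(z − o).val = z.val + w + 1 + 2b`. -/
theorem val_sub_origin_of_pos (z : ZMod (2 * L + 1)) (hz : z.val + (w + 1 + 2 * b) < 2 * L + 1) :
    (z - -(((w + 1 + 2 * b : ℕ) : ZMod (2 * L + 1)))).val = z.val + (w + 1 + 2 * b) := by
  rw [sub_neg_eq_add, ZMod.val_add, ZMod.val_natCast_of_lt (by omega), Nat.mod_eq_of_lt hz]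

/-- `K b ≥ 2L + 2 − 2b` for `K + 1 = (2L+1)/b`. -/
theorem two_mul_add_two_le (hb : 0 < b) (hK : K + 1 = (2 * L + 1) / b) :
    2 * L + 2 ≤ K * b + 2 * b := by
  have h1 : 2 * L + 1 < (2 * L + 1) / b * b + b := Nat.lt_div_mul_add hb
  rw [← hK] at h1
  have : (K + 1) * b = K * b + b := by ring
  omega

/-- **Labels of the reflected slab.** With `o = −(w+1+2b)`, `4b ≤ L`, `w ≤ L`: a time `z` with
`2L − w ≤ z.val` has label in `[2, 2 + w/b]`. -/
theorem label_negSlab (hb : 0 < b) (hK : K + 1 = (2 * L + 1) / b) (hbL : 4 * b ≤ L) (hwL : w ≤ L)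
    (z : ZMod (2 * L + 1)) (hz : 2 * L - w ≤ z.val) :
    2 ≤ StubTorusFrames.ulabel b K (z - -(((w + 1 + 2 * b : ℕ) : ZMod (2 * L + 1)))).val ∧
      StubTorusFrames.ulabel b K (z - -(((w + 1 + 2 * b : ℕ) : ZMod (2 * L + 1)))).val ≤ 2 + w / b := by
  have hzlt := ZMod.val_lt z
  have hKb := two_mul_add_two_le hb hK
  rw [val_sub_origin_of_neg (by omega) z hz]
  obtain ⟨j, hj, hje⟩ : ∃ j, j ≤ w ∧ z.val + (w + 1 + 2 * b) - (2 * L + 1) = j + 2 * b :=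
    ⟨z.val + w - 2 * L, by omega, by omega⟩
  rw [hje, ulabel_eq_div hb (by nlinarith), Nat.add_mul_div_right _ _ hb]
  exact ⟨Nat.le_add_left 2 _, by have := Nat.div_le_div_right (c := b) hj; omega⟩

/-- **Labels of the shifted slab.** With `o = −(w+1+2b)`, `4b ≤ L`, `N + 2w ≤ L`: a time `z` with
`N + 1 ≤ z.val ≤ N + w` has label in `[(N+w+2)/b + 2, (N+2w+1)/b + 2]`. -/
theorem label_posSlab (hb : 0 < b) (hK : K + 1 = (2 * L + 1) / b) (hbL : 4 * b ≤ L)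
    (hNw : N + 2 * w ≤ L) (z : ZMod (2 * L + 1)) (hz1 : N + 1 ≤ z.val) (hz2 : z.val ≤ N + w) :
    (N + w + 2) / b + 2 ≤ StubTorusFrames.ulabel b K (z - -(((w + 1 + 2 * b : ℕ) : ZMod (2 * L + 1)))).val ∧
      StubTorusFrames.ulabel b K (z - -(((w + 1 + 2 * b : ℕ) : ZMod (2 * L + 1)))).val ≤
        (N + 2 * w + 1) / b + 2 := by
  have hKb := two_mul_add_two_le hb hK
  rw [val_sub_origin_of_pos z (by omega)]
  have he : z.val + (w + 1 + 2 * b) = (z.val + w + 1) + 2 * b := by ring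
  rw [he, ulabel_eq_div hb (by nlinarith), Nat.add_mul_div_right _ _ hb]
  constructor
  · have := Nat.div_le_div_right (c := b) (show N + w + 2 ≤ z.val + w + 1 by omega); omega
  · have := Nat.div_le_div_right (c := b) (show z.val + w + 1 ≤ N + 2 * w + 1 by omega); omega

/-- **The two label intervals are apart** (far case `3b ≤ N`, with `4b ≤ L`, `N + 2w ≤ L`): with
`f₂ = 2 + w/b`, `g₁ = (N+w+2)/b + 2`, `g₂ = (N+2w+1)/b + 2`, one has `f₂ + 1 < g₁ − 1`,
`g₂ + 1 ≤ K`, and for the adjacent labels `ℓ₁ ∈ {1, f₂+1}`, `ℓ₂ ∈ {g₁−1, g₂+1}`: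
`N/b − 3 ≤ ℓ₂ − ℓ₁` and `N/b − 3 ≤ K + 1 − (ℓ₂ − ℓ₁)`. -/
theorem slab_labels_apart (hb : 0 < b) (hK : K + 1 = (2 * L + 1) / b) (hbL : 4 * b ≤ L)
    (hNw : N + 2 * w ≤ L) (hN : 3 * b ≤ N) :
    2 + w / b + 1 < (N + w + 2) / b + 2 - 1 ∧ (N + 2 * w + 1) / b + 2 + 1 ≤ K ∧
      ∀ ℓ₁ ℓ₂ : ℕ, (ℓ₁ = 1 ∨ ℓ₁ = 2 + w / b + 1) →
        (ℓ₂ = (N + w + 2) / b + 2 - 1 ∨ ℓ₂ = (N + 2 * w + 1) / b + 2 + 1) →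
          ℓ₁ ≤ ℓ₂ ∧ N / b - 3 ≤ ℓ₂ - ℓ₁ ∧ N / b - 3 ≤ K + 1 - (ℓ₂ - ℓ₁) := by
  have hKb := two_mul_add_two_le hb hK
  have ha : 3 ≤ N / b := (Nat.le_div_iff_mul_le hb).2 hN
  have hb' : N / b + w / b ≤ (N + w + 2) / b :=
    (Nat.add_div_le_add_div N w b).trans (Nat.div_le_div_right (by omega))
  have hc : (N + 2 * w + 1) / b + 2 < K := by
    rw [← Nat.add_mul_div_right _ _ hb, Nat.div_lt_iff_lt_mul hb]
    omega
  have hd : (N + 2 * w + 1) / b + N / b ≤ K + 1 := by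
    rw [hK]
    exact (Nat.add_div_le_add_div _ _ _).trans (Nat.div_le_div_right (by omega))
  have he : (N + w + 2) / b ≤ (N + 2 * w + 1) / b + 1 := by
    rw [← Nat.add_div_right _ hb]
    exact Nat.div_le_div_right (by omega)
  have hg : N / b + w / b ≤ (N + 2 * w + 1) / b :=
    (Nat.add_div_le_add_div N w b).trans (Nat.div_le_div_right (by omega))
  clear hKb hK hN hNw hbL hb
  generalize N / b = nb at *
  generalize w / b = wb at *
  generalize (N + w + 2) / b = g₁ at *
  generalize (N + 2 * w + 1) / b = g₂ at *
  refine ⟨by omega, by omega, fun ℓ₁ ℓ₂ h₁ h₂ => ?_⟩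
  rcases h₁ with rfl | rfl <;> rcases h₂ with rfl | rfl <;> exact ⟨by omega, by omega, by omega⟩

/-- **Time coordinates of a plaquette based in the shadow of an edge set**: if `x ∈ edgeShadow Λ`
then `x⁰ = t` or `x⁰ = t − 1` for the base time `t` of some link of `Λ`, and the links of a
plaquette based at `x` are based at times `x⁰` or `x⁰ + 1`. -/
theorem edgeShadow_time {Sd : ℕ} {Λ : Finset (Edge 4 Sd)} {x : Site 4 Sd} (hx : x ∈ edgeShadow Λ) :
    ∃ e ∈ Λ, x 0 = e.1 0 ∨ x 0 = e.1 0 - 1 := by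
  rcases Finset.mem_union.1 hx with h | h
  · obtain ⟨e, he, rfl⟩ := Finset.mem_image.1 h
    exact ⟨e, he, Or.inl rfl⟩
  · obtain ⟨⟨e, m⟩, hem, rfl⟩ := Finset.mem_image.1 h
    refine ⟨e, (Finset.mem_product.1 hem).1, ?_⟩
    by_cases hm : m = 0
    · subst hm; right; simp
    · left; simp [Ne.symm hm]

/-- The base time of `x + eᵢ` is `x⁰` or `x⁰ + 1`. -/
theorem shift_time {Sd : ℕ} (x : Site 4 Sd) (i : Fin 4) :
    (x.shift i) 0 = x 0 ∨ (x.shift i) 0 = x 0 + 1 := by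
  by_cases hi : i = 0
  · subst hi; right; simp [Site.shift]
  · left; simp [Site.shift, Ne.symm hi]

end Slabs

end SlabClustering

end

end Summit.QuantumFields.YangMills.Cruxes.LatticeGapOnTrajectory.OrbitKantorovichFiniteSize
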